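import Literature.NumberTheory.Weil1964.AdelicMetaplecticContinuous
import Literature.NumberTheory.Automorphic.AdelicTensorStrippingCovariant
import HarnessLib

/-!
# Tensor stripping in the adelic metaplectic group: `M = A_∞ ⊗ M_f`

Origin: `pub-hodgecm` MODEL-CONSTRUCTION sub-cell, node W2-⊗ (⊗S)-𝔸 (ii) (adelic assembly of the tensor
decomposition). KERNEL MATHEMATICS ONLY: no `def … : Prop` records, no `axiom`, no proof hole.

The instantiation of the covariant tensor stripping theorem
(`Automorphic/AdelicTensorStrippingCovariant.lean`) at THE GLOBAL SCHRÖDINGER REPRESENTATION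
`ρ = adelicSchrodinger F ι T` of the adelic Heisenberg group on `𝒮(𝔸_F^ι)`: for an implementing pair
`(g, M) ∈ Mp_ψ(W_𝔸)` ([MoeglinVignerasWaldspurger1987, Chap. 2 II.1 (A)]: `M ρ(h) = ρ(g h) M` for all `h`) and a
linear automorphism `M_f` of the finite factor `𝒮((𝔸_F^∞)^ι)` such that `1 ⊗ M_f` implements `g` on the FINITE
Heisenberg elements (those `h = (w, t)` with `w` supported at the finite places), the quotient `M ∘ (1 ⊗ M_f)⁻¹`
commutes with all finite translations and modulations, hence (archimedean tensor stripping) **`M = A_∞ ⊗ M_f`**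
with `A_∞` a linear operator of `𝓢((F ⊗ ℝ)^ι)`, CONTINUOUS — indeed a topological automorphism together with
`M⁻¹ = A_∞⁻¹ ⊗ M_f⁻¹` — when `(g, M)` lies in the LF-continuous metaplectic group `Mp_ψ(W_𝔸)ᶜᵒⁿᵗ`
(`adelicMpCont`). This is the operator-level form of Weil's factorisation `𝐫_A(s) = ⊗_v 𝐫_v(s_v)` of the adelic
metaplectic representation over the finite places [Weil1964, Chap. III n° 37–38 p. 188–190].

* §1 the finite idempotent `e_f = (0, 1) ∈ 𝔸_F = F_∞ × 𝔸_F^∞` and the set `finHeisenberg T` of Heisenberg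
  elements with `e_f · w = w`; its stability under every `g ∈ Sp(W_𝔸)` (`𝔸_F`-linearity);
* §2 the DICTIONARY between Weil's operators of the Schrödinger representation and the translation / modulation
  operators of the stripping files: `ρ((x,0),0) = translateLM x`, `ρ((0,y),0) = modulateLM (T y)`; every finite
  modulation `M_(0,y)` is a `ρ((0,y'),0)` with `y'` FINITE when `y ↦ T y` is onto;
* §3 the theorems `eq_adelicTensorEnd_archPart_of_mem_adelicMp` (algebraic) and
  `exists_continuousLinearEquiv_of_mem_adelicMpCont` (topological).

## References
* [Weil1964] A. Weil, *Sur certains groupes d'opérateurs unitaires*, Acta Math. 111 (1964) 143–211, Chap. I n° 4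
  p. 149 (the operators `U(w)`), Chap. III n° 37–38 p. 188–190 (adelic metaplectic group and `𝐫_A = ⊗ 𝐫_v`).
* [MoeglinVignerasWaldspurger1987] C. Mœglin, M.-F. Vignéras, J.-L. Waldspurger, *Correspondances de Howe sur un
  corps p-adique*, LNM 1291 (1987), Chap. 2 I.4 Exemple (1), II.1 (A).
* [GelbartRogawski1991] S. Gelbart, J. Rogawski, *L-functions and Fourier–Jacobi coefficients for the unitary
  group U(3)*, Invent. math. 105 (1991) 445–472, §3.1 p. 454 (`Mp_𝐀(W)`).
-/

set_option autoImplicit false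

noncomputable section

open scoped Matrix SchwartzMap TensorProduct Classical

open NumberField NumberField.mixedEmbedding IsDedekindDomain

namespace Literature.NumberTheory.Weil1964

open Literature.NumberTheory.Automorphic Literature.RepresentationTheory.HeisenbergGroup

variable {F : Type} [Field F] [NumberField F] {ι : Type}

/-! ### §1 The finite idempotent and the finite Heisenberg elements -/

section FiniteIdempotent

variable (F) in
/-- The idempotent `e_f = (0, 1)` of `𝔸_F = F_∞ × 𝔸_F^∞` cutting out the finite adeles. [folklore] -/
def finIdem : AdeleRing (𝓞 F) F := ((0 : InfiniteAdeleRing F), (1 : FiniteAdeleRing (𝓞 F) F))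

/-- archimedean component of `e_f`. [folklore] -/
@[simp] theorem finIdem_fst : (finIdem F).1 = 0 := rfl

/-- finite component of `e_f`. [folklore] -/
@[simp] theorem finIdem_snd : (finIdem F).2 = 1 := rfl

/-- `e_f · a = (0, a_f)`. [folklore] -/
theorem finIdem_mul (a : AdeleRing (𝓞 F) F) : finIdem F * a = ((0 : InfiniteAdeleRing F), a.2) :=
  Prod.ext (zero_mul a.1) (one_mul a.2)

/-- `e_f` is idempotent. [folklore] -/
@[simp] theorem finIdem_mul_self : finIdem F * finIdem F = finIdem F :=
  Prod.ext (zero_mul _) (one_mul _)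

/-- `e_f · a = a ↔ a_∞ = 0`. [folklore] -/
theorem finIdem_mul_eq_self_iff (a : AdeleRing (𝓞 F) F) : finIdem F * a = a ↔ a.1 = 0 :=
  ⟨fun h => (congrArg Prod.fst h).symm.trans (zero_mul a.1),
    fun h => Prod.ext ((zero_mul a.1).trans h.symm) (one_mul a.2)⟩

/-- The finite vectors `(0, k)` of the splitting `𝔸_F^ι ≅ (F ⊗ ℝ)^ι × (𝔸_F^∞)^ι` are fixed by `e_f`. [folklore] -/
@[simp] theorem finIdem_smul_piAdeleSplit_zero (k : ι → FiniteAdeleRing (𝓞 F) F) :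
    finIdem F • piAdeleSplit F ι (0, k) = piAdeleSplit F ι (0, k) := by
  funext i
  rw [Pi.smul_apply, smul_eq_mul, finIdem_mul_eq_self_iff, piAdeleSplit_apply_fst]
  exact map_zero (InfiniteAdeleRing.ringEquiv_mixedSpace F).symm

variable [Fintype ι] [DecidableEq ι] (T : Matrix ι ι (AdeleRing (𝓞 F) F))

/-- **The finite Heisenberg elements**: `h = (w, t) ∈ H(W_𝔸)` with `e_f · w = w` (vector part supported at the
finite places; the central part is unrestricted). [cite: Weil1964, Chap. III n° 37 p. 188] -/
def finHeisenberg : Set (AdelicHeisenberg F ι T) := {h | finIdem F • h.v = h.v}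

variable {T}

/-- Membership in `finHeisenberg`. [folklore] -/
theorem mem_finHeisenberg_iff (h : AdelicHeisenberg F ι T) : h ∈ finHeisenberg T ↔ finIdem F • h.v = h.v :=
  Iff.rfl

/-- `((x, y), 0)` is a finite Heisenberg element when `x`, `y` are finite vectors. [folklore] -/
theorem ofVec_mem_finHeisenberg {x y : ι → AdeleRing (𝓞 F) F} (hx : finIdem F • x = x)
    (hy : finIdem F • y = y) : Heisenberg.ofVec (polar (adelicForm F ι T)) (x, y) ∈ finHeisenberg T := by
  rw [mem_finHeisenberg_iff, Heisenberg.ofVec_v, Prod.smul_mk, hx, hy]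

/-- **`finHeisenberg` is stable under every `(σ, f) ∈ B₀(W_𝔸)`** (`σ` is `𝔸_F`-linear, so it commutes with
`e_f`). [folklore] -/
theorem act_mem_finHeisenberg (s : Heisenberg.PseudoSymplectic (polar (adelicForm F ι T)))
    {h : AdelicHeisenberg F ι T} (hh : h ∈ finHeisenberg T) : s.act h ∈ finHeisenberg T := by
  rw [mem_finHeisenberg_iff] at hh ⊢
  rw [Heisenberg.PseudoSymplectic.act_v, ← map_smul, hh]

/-- **`h ↦ g h` maps `finHeisenberg` ONTO itself** for every `g ∈ Sp(W_𝔸)` (the preimage of `h'` is `g⁻¹ h'`).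
[folklore] -/
theorem exists_act_eq_of_mem_finHeisenberg (g : symplecticGroup (polar (adelicForm F ι T)))
    (h' : AdelicHeisenberg F ι T) (hh' : h' ∈ finHeisenberg T) :
    ∃ h ∈ finHeisenberg T, (ofSymplectic (polar (adelicForm F ι T)) g).act h = h' :=
  ⟨(ofSymplectic (polar (adelicForm F ι T)) g⁻¹).act h', act_mem_finHeisenberg _ hh', by
    rw [← Heisenberg.PseudoSymplectic.act_mul_act, ← map_mul, mul_inv_cancel, map_one,
      Heisenberg.PseudoSymplectic.act_one]⟩

end FiniteIdempotent

/-! ### §2 The dictionary: Weil's operators versus `translateLM` / `modulateLM` -/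

section Dictionary

variable [Fintype ι] [DecidableEq ι] (T : Matrix ι ι (AdeleRing (𝓞 F) F))

/-- **`ρ((x, 0), 0) = T_x`**: the Schrödinger operator of `((x,0),0)` is the translation operator `translateLM x`
(`Φ(· + x) = Φ(x + ·)`). [cite: Weil1964, Chap. I n° 4 p. 149] -/
theorem adelicSchrodinger_ofVec_inl_eq_translateLM (x : ι → AdeleRing (𝓞 F) F) :
    adelicSchrodinger F ι T (Heisenberg.ofVec (polar (adelicForm F ι T)) (x, 0)) = translateLM F ι x := by
  apply LinearMap.ext
  intro Φ
  apply Subtype.ext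
  rw [coe_adelicSchrodinger_ofVec_inl, coe_translateLM_apply]
  funext u
  rw [translate_apply, add_comm]

/-- **`ρ((0, y), 0) = M_{T y}`**: the Schrödinger operator of `((0,y),0)` is the modulation operator
`modulateLM (T y)` (`ψ_F(⟨u, T y⟩) = ψ_F(Σ_i (T y)_i u_i)`). [cite: Weil1964, Chap. I n° 4 p. 149] -/
theorem adelicSchrodinger_ofVec_inr_eq_modulateLM (y : ι → AdeleRing (𝓞 F) F) :
    adelicSchrodinger F ι T (Heisenberg.ofVec (polar (adelicForm F ι T)) (0, y)) = modulateLM F ι (T *ᵥ y) := by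
  apply LinearMap.ext
  intro Φ
  apply Subtype.ext
  rw [coe_adelicSchrodinger_ofVec_inr, coe_modulateLM_apply]
  funext u
  rw [mulChar_apply, linChar_apply, dotProduct_comm]
  rfl

variable {T}

omit [DecidableEq ι] in
/-- **Finite modulations are Schrödinger operators of FINITE elements**: if `y ↦ T y` is onto, every finite
vector `(0, y)` of the splitting is `T y'` with `e_f · y' = y'`. [folklore] -/
theorem exists_fin_mulVec_eq (hT : Function.Surjective fun y : ι → AdeleRing (𝓞 F) F => T *ᵥ y)
    (y : ι → FiniteAdeleRing (𝓞 F) F) :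
    ∃ y' : ι → AdeleRing (𝓞 F) F, finIdem F • y' = y' ∧ T *ᵥ y' = piAdeleSplit F ι (0, y) := by
  obtain ⟨z, hz⟩ := hT (piAdeleSplit F ι (0, y))
  have hz' : T *ᵥ z = piAdeleSplit F ι (0, y) := hz
  refine ⟨finIdem F • z, by rw [smul_smul, finIdem_mul_self], ?_⟩
  rw [Matrix.mulVec_smul, hz', finIdem_smul_piAdeleSplit_zero]

/-- Every finite translation `T_(0,k)` is a `ρ h`, `h ∈ finHeisenberg`. [folklore] -/
theorem exists_mem_finHeisenberg_eq_translateLM (k : ι → FiniteAdeleRing (𝓞 F) F) :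
    ∃ h ∈ finHeisenberg T, adelicSchrodinger F ι T h = translateLM F ι (piAdeleSplit F ι (0, k)) :=
  ⟨Heisenberg.ofVec (polar (adelicForm F ι T)) (piAdeleSplit F ι (0, k), 0),
    ofVec_mem_finHeisenberg (finIdem_smul_piAdeleSplit_zero k) (smul_zero _),
    adelicSchrodinger_ofVec_inl_eq_translateLM T _⟩

/-- Every finite modulation `M_(0,y)` is a `ρ h`, `h ∈ finHeisenberg` (for `y ↦ T y` onto). [folklore] -/
theorem exists_mem_finHeisenberg_eq_modulateLM
    (hT : Function.Surjective fun y : ι → AdeleRing (𝓞 F) F => T *ᵥ y) (y : ι → FiniteAdeleRing (𝓞 F) F) :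
    ∃ h ∈ finHeisenberg T, adelicSchrodinger F ι T h = modulateLM F ι (piAdeleSplit F ι (0, y)) := by
  obtain ⟨y', hy', hTy'⟩ := exists_fin_mulVec_eq hT y
  exact ⟨Heisenberg.ofVec (polar (adelicForm F ι T)) (0, y'), ofVec_mem_finHeisenberg (smul_zero _) hy', by
    rw [adelicSchrodinger_ofVec_inr_eq_modulateLM, hTy']⟩

end Dictionary

/-! ### §3 `M = A_∞ ⊗ M_f` for implementing pairs -/

section Stripping

variable [Fintype ι] [DecidableEq ι] {T : Matrix ι ι (AdeleRing (𝓞 F) F)}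

/-- **Algebraic form.** Let `(g, M) ∈ Mp_ψ(W_𝔸)` and let `M_f` be a linear automorphism of `𝒮((𝔸_F^∞)^ι)`
such that `1 ⊗ M_f` implements `g` on the finite Heisenberg elements. If `y ↦ T y` is onto, then
`M = A_∞ ⊗ M_f` with `A_∞ = archPart (M ∘ (1 ⊗ M_f⁻¹))`. [cite: Weil1964, Chap. III n° 37–38 p. 188–190] -/
theorem eq_adelicTensorEnd_archPart_of_mem_adelicMp
    (hT : Function.Surjective fun y : ι → AdeleRing (𝓞 F) F => T *ᵥ y) (p : adelicMp F ι T)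
    (Mf : FinSB F ι ≃ₗ[ℂ] FinSB F ι)
    (hMf : ∀ h ∈ finHeisenberg T, ∀ Φ : piSchwartzBruhat F ι,
      adelicTensorEnd LinearMap.id (Mf : FinSB F ι →ₗ[ℂ] FinSB F ι) (adelicSchrodinger F ι T h Φ) =
        adelicSchrodinger F ι T
          ((ofSymplectic (polar (adelicForm F ι T))
            (p : symplecticGroup (polar (adelicForm F ι T)) × (piSchwartzBruhat F ι ≃ₗ[ℂ] piSchwartzBruhat F ι)).1).act
              h)
          (adelicTensorEnd LinearMap.id (Mf : FinSB F ι →ₗ[ℂ] FinSB F ι) Φ)) :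
    ((p : symplecticGroup (polar (adelicForm F ι T)) × (piSchwartzBruhat F ι ≃ₗ[ℂ] piSchwartzBruhat F ι)).2 :
        piSchwartzBruhat F ι →ₗ[ℂ] piSchwartzBruhat F ι) =
      adelicTensorEnd
        (archPart (((p : symplecticGroup (polar (adelicForm F ι T)) ×
            (piSchwartzBruhat F ι ≃ₗ[ℂ] piSchwartzBruhat F ι)).2 :
              piSchwartzBruhat F ι →ₗ[ℂ] piSchwartzBruhat F ι) ∘ₗ
          adelicTensorEnd LinearMap.id (Mf.symm : FinSB F ι →ₗ[ℂ] FinSB F ι)))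
        (Mf : FinSB F ι →ₗ[ℂ] FinSB F ι) := by
  have hImp : Implements (adelicSchrodinger F ι T)
      (ofSymplectic (polar (adelicForm F ι T))
        (p : symplecticGroup (polar (adelicForm F ι T)) × (piSchwartzBruhat F ι ≃ₗ[ℂ] piSchwartzBruhat F ι)).1)
      (p : symplecticGroup (polar (adelicForm F ι T)) × (piSchwartzBruhat F ι ≃ₗ[ℂ] piSchwartzBruhat F ι)).2 :=
    (mem_MpPsi _ _).1 p.2
  exact eq_adelicTensorEnd_archPart_of_covariant (U := ⇑(adelicSchrodinger F ι T))
    (s := (ofSymplectic (polar (adelicForm F ι T))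
      (p : symplecticGroup (polar (adelicForm F ι T)) × (piSchwartzBruhat F ι ≃ₗ[ℂ] piSchwartzBruhat F ι)).1).act)
    (S := finHeisenberg T)
    (fun h' hh' => exists_act_eq_of_mem_finHeisenberg _ h' hh')
    (fun k => exists_mem_finHeisenberg_eq_translateLM k)
    (fun y => exists_mem_finHeisenberg_eq_modulateLM hT y)
    (fun h _ => LinearMap.ext fun Φ => hImp h Φ)
    (fun h hh => LinearMap.ext fun Φ => hMf h hh Φ)

/-- **Topological form.** Let `(g, M) ∈ Mp_ψ(W_𝔸)ᶜᵒⁿᵗ` (LF-continuous implementers) and let `M_f` be a linear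
automorphism of `𝒮((𝔸_F^∞)^ι)` such that `1 ⊗ M_f` implements `g` on the finite Heisenberg elements; assume
`y ↦ T y` onto. Then there is a TOPOLOGICAL AUTOMORPHISM `A_∞` of `𝓢((F ⊗ ℝ)^ι)` with `M = A_∞ ⊗ M_f` and
`M⁻¹ = A_∞⁻¹ ⊗ M_f⁻¹`. [cite: Weil1964, Chap. III n° 37–38 p. 188–190] -/
theorem exists_continuousLinearEquiv_of_mem_adelicMpCont
    (hT : Function.Surjective fun y : ι → AdeleRing (𝓞 F) F => T *ᵥ y) (p : adelicMp F ι T)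
    (hp : p ∈ adelicMpCont F ι T) (Mf : FinSB F ι ≃ₗ[ℂ] FinSB F ι)
    (hMf : ∀ h ∈ finHeisenberg T, ∀ Φ : piSchwartzBruhat F ι,
      adelicTensorEnd LinearMap.id (Mf : FinSB F ι →ₗ[ℂ] FinSB F ι) (adelicSchrodinger F ι T h Φ) =
        adelicSchrodinger F ι T
          ((ofSymplectic (polar (adelicForm F ι T))
            (p : symplecticGroup (polar (adelicForm F ι T)) × (piSchwartzBruhat F ι ≃ₗ[ℂ] piSchwartzBruhat F ι)).1).act
              h)
          (adelicTensorEnd LinearMap.id (Mf : FinSB F ι →ₗ[ℂ] FinSB F ι) Φ)) :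
    ∃ A : 𝓢((ι → mixedSpace F), ℂ) ≃L[ℂ] 𝓢((ι → mixedSpace F), ℂ),
      (((p : symplecticGroup (polar (adelicForm F ι T)) × (piSchwartzBruhat F ι ≃ₗ[ℂ] piSchwartzBruhat F ι)).2 :
            piSchwartzBruhat F ι →ₗ[ℂ] piSchwartzBruhat F ι) =
          adelicTensorEnd (A : 𝓢((ι → mixedSpace F), ℂ) →ₗ[ℂ] 𝓢((ι → mixedSpace F), ℂ))
            (Mf : FinSB F ι →ₗ[ℂ] FinSB F ι)) ∧
        (((p : symplecticGroup (polar (adelicForm F ι T)) × (piSchwartzBruhat F ι ≃ₗ[ℂ] piSchwartzBruhat F ι)).2.symm :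
            piSchwartzBruhat F ι →ₗ[ℂ] piSchwartzBruhat F ι) =
          adelicTensorEnd (A.symm : 𝓢((ι → mixedSpace F), ℂ) →ₗ[ℂ] 𝓢((ι → mixedSpace F), ℂ))
            (Mf.symm : FinSB F ι →ₗ[ℂ] FinSB F ι)) := by
  have hImp : Implements (adelicSchrodinger F ι T)
      (ofSymplectic (polar (adelicForm F ι T))
        (p : symplecticGroup (polar (adelicForm F ι T)) × (piSchwartzBruhat F ι ≃ₗ[ℂ] piSchwartzBruhat F ι)).1)
      (p : symplecticGroup (polar (adelicForm F ι T)) × (piSchwartzBruhat F ι ≃ₗ[ℂ] piSchwartzBruhat F ι)).2 :=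
    (mem_MpPsi _ _).1 p.2
  have hPlf : (p : symplecticGroup (polar (adelicForm F ι T)) ×
      (piSchwartzBruhat F ι ≃ₗ[ℂ] piSchwartzBruhat F ι)).2 ∈ lfUnits F ι :=
    (mem_adelicMpCont_iff p).1 hp
  exact exists_continuousLinearEquiv_eq_adelicTensorEnd_of_covariant (U := ⇑(adelicSchrodinger F ι T))
    (s := (ofSymplectic (polar (adelicForm F ι T))
      (p : symplecticGroup (polar (adelicForm F ι T)) × (piSchwartzBruhat F ι ≃ₗ[ℂ] piSchwartzBruhat F ι)).1).act)
    (S := finHeisenberg T) _ hPlf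
    (fun h' hh' => exists_act_eq_of_mem_finHeisenberg _ h' hh')
    (fun k => exists_mem_finHeisenberg_eq_translateLM k)
    (fun y => exists_mem_finHeisenberg_eq_modulateLM hT y)
    (fun h _ => LinearMap.ext fun Φ => hImp h Φ)
    (fun h hh => LinearMap.ext fun Φ => hMf h hh Φ)

/-- Pointwise form on pure tensors: `M (Φ_∞ ⊗ f) = A_∞ Φ_∞ ⊗ M_f f` and `M⁻¹ (Φ_∞ ⊗ f) = A_∞⁻¹ Φ_∞ ⊗ M_f⁻¹ f`.
[cite: Weil1964, Chap. III n° 37–38 p. 188–190] -/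
theorem exists_continuousLinearEquiv_map_tmul_of_mem_adelicMpCont
    (hT : Function.Surjective fun y : ι → AdeleRing (𝓞 F) F => T *ᵥ y) (p : adelicMp F ι T)
    (hp : p ∈ adelicMpCont F ι T) (Mf : FinSB F ι ≃ₗ[ℂ] FinSB F ι)
    (hMf : ∀ h ∈ finHeisenberg T, ∀ Φ : piSchwartzBruhat F ι,
      adelicTensorEnd LinearMap.id (Mf : FinSB F ι →ₗ[ℂ] FinSB F ι) (adelicSchrodinger F ι T h Φ) =
        adelicSchrodinger F ι T
          ((ofSymplectic (polar (adelicForm F ι T))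
            (p : symplecticGroup (polar (adelicForm F ι T)) × (piSchwartzBruhat F ι ≃ₗ[ℂ] piSchwartzBruhat F ι)).1).act
              h)
          (adelicTensorEnd LinearMap.id (Mf : FinSB F ι →ₗ[ℂ] FinSB F ι) Φ)) :
    ∃ A : 𝓢((ι → mixedSpace F), ℂ) ≃L[ℂ] 𝓢((ι → mixedSpace F), ℂ),
      ∀ (Φinf : 𝓢((ι → mixedSpace F), ℂ)) (f : FinSB F ι),
        (p : symplecticGroup (polar (adelicForm F ι T)) × (piSchwartzBruhat F ι ≃ₗ[ℂ] piSchwartzBruhat F ι)).2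
            (piSchwartzBruhatEquiv F ι (Φinf ⊗ₜ f)) = piSchwartzBruhatEquiv F ι (A Φinf ⊗ₜ Mf f) ∧
          (p : symplecticGroup (polar (adelicForm F ι T)) × (piSchwartzBruhat F ι ≃ₗ[ℂ] piSchwartzBruhat F ι)).2.symm
            (piSchwartzBruhatEquiv F ι (Φinf ⊗ₜ f)) = piSchwartzBruhatEquiv F ι (A.symm Φinf ⊗ₜ Mf.symm f) := by
  obtain ⟨A, hA, hA'⟩ := exists_continuousLinearEquiv_of_mem_adelicMpCont hT p hp Mf hMf
  refine ⟨A, fun Φinf f => ⟨?_, ?_⟩⟩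
  · rw [← LinearEquiv.coe_coe, hA, adelicTensorEnd_apply_tmul]
    rfl
  · rw [← LinearEquiv.coe_coe, hA', adelicTensorEnd_apply_tmul]
    rfl

end Stripping

end Literature.NumberTheory.Weil1964

end
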